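import Mathlib
import Summits.NavierStokesRegularity.NavierStokesRegularity.Theorems.FilamentSkeletonRssClause13CutoffCommutator
import Summits.NavierStokesRegularity.NavierStokesRegularity.Theorems.FilamentSkeletonRssClause13PartitionKernels

/-!
# Clause 13-J/13-R, brick n3 LAYER B (PIECES): regularity, integrability and weighted `L²` bounds of a cut-off piece
# `P(x) = ∫ k(x−y)Y(y)dy` of a compactly supported variation `Y`

Route `FilamentSkeletonRss`, ∃-side clause 13 (`Clause13RNearStraightL` stmt-NavierStokesRegularity-23612; typing-agnostic); design
`filament-plan/DESIGN-28296-model-gluing-g16.md` §2–§3.  The window estimates (`model_lowRegime_dirichlet_estimate`, `model_selfForm_bound`,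
`model_band_estimate`, `model_farBranch_energy`) are stated for a function with hypotheses `Y ∈ L¹ ∩ L²`, `x·Y ∈ L¹`, `(τ−c)Y, (τ−c)Y′ ∈ L²`, …;
the gluing applies them to the PIECES `P = k∗Y` of a `C¹_c` variation `Y` (ball `[c−R, c+R]`) cut off by a real kernel `k` with `k, t·k ∈ L¹`
(`…Clause13PartitionKernels`).  This file discharges those hypotheses once and for all and records the constants:

* §1 `piece_eq_convolution`, `continuous_piece`, `hasDerivAt_piece` (`P′ = k∗Y′`, Mathlib `HasCompactSupport.hasDerivAt_convolution_right`);
* §2 `norm_piece_le` (`‖P(x)‖ ≤ ∫|k(x−y)|‖Y(y)‖dy`), `integral_sq_norm_piece_le` (`∫‖P‖² ≤ ‖k‖₁²∫‖Y‖²`, Schur–Young p693953), `memLp_piece`,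
  `integrable_piece` (`L¹×L¹`);
* §3 weights: `norm_weight_mul_piece_le` (`|x−c|‖P(x)‖ ≤ ∫|k(x−y)||y−c|‖Y‖ + ∫|x−y||k(x−y)|‖Y‖`), `integral_sq_norm_weight_piece_le`
  (`∫‖(τ−c)P‖² ≤ 2‖k‖₁²∫‖(τ−c)Y‖² + 2‖t k‖₁²∫‖Y‖²`), `memLp_weight_piece`, `integrable_smul_piece` (`x·P ∈ L¹`).
The same lemmas applied to `Y′` give the facts for `P′` (`hasDerivAt_piece`).
Lane ns-filament-19175-p1 g16; `--supports stmt-NavierStokesRegularity-23612 --as helper`.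
HONEST FRAMING: harmonic-analysis bookkeeping attached to a HYPOTHETICAL filament skeleton's linearised operator on the NEGATIVE side of a MODEL route;
nothing here bears on Navier–Stokes regularity or blow-up.
-/

noncomputable section

open MeasureTheory Real Complex Filter Set
open scoped ComplexConjugate Topology Convolution

namespace Summit.NavierStokesRegularity.NavierStokesRegularity.Theorems.MatchedKernel
set_option linter.dupNamespace false

/-! ## §1 The piece as a convolution; continuity and derivative -/

/-- The explicit integral is Mathlib's real-bilinear convolution `(↑k) ⋆[mul ℝ ℂ] Y`. [folklore] -/
theorem piece_eq_convolution (k : ℝ → ℝ) (Y : ℝ → ℂ) :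
    (fun x : ℝ => ∫ y : ℝ, ((k (x - y) : ℝ) : ℂ) * Y y) = (fun t : ℝ => ((k t : ℝ) : ℂ)) ⋆[ContinuousLinearMap.mul ℝ ℂ, volume] Y := by
  funext x
  rw [convolution_eq_swap]
  simp only [ContinuousLinearMap.mul_apply']

/-- The piece is continuous (`k` locally integrable, `Y` continuous with compact support). [folklore] -/
theorem continuous_piece {k : ℝ → ℝ} (hkc : Continuous k) {Y : ℝ → ℂ} (hYc : Continuous Y) (hYs : HasCompactSupport Y) :
    Continuous fun x : ℝ => ∫ y : ℝ, ((k (x - y) : ℝ) : ℂ) * Y y := by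
  rw [piece_eq_convolution]
  exact hYs.continuous_convolution_right _ (Complex.continuous_ofReal.comp hkc).locallyIntegrable hYc

/-- **`P′ = k∗Y′`**: the piece of a `C¹_c` variation is differentiable with derivative the piece of `Y′`. [folklore] -/
theorem hasDerivAt_piece {k : ℝ → ℝ} (hkc : Continuous k) {Y : ℝ → ℂ} (hY : ContDiff ℝ 1 Y) (hYs : HasCompactSupport Y) (x : ℝ) :
    HasDerivAt (fun x : ℝ => ∫ y : ℝ, ((k (x - y) : ℝ) : ℂ) * Y y) (∫ y : ℝ, ((k (x - y) : ℝ) : ℂ) * deriv Y y) x := by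
  rw [piece_eq_convolution]
  have h := hYs.hasDerivAt_convolution_right (ContinuousLinearMap.mul ℝ ℂ) (μ := volume)
    (Complex.continuous_ofReal.comp hkc).locallyIntegrable hY x
  have e : ((fun t : ℝ => ((k t : ℝ) : ℂ)) ⋆[ContinuousLinearMap.mul ℝ ℂ, volume] deriv Y) x
      = ∫ y : ℝ, ((k (x - y) : ℝ) : ℂ) * deriv Y y := by
    rw [convolution_eq_swap]; simp only [ContinuousLinearMap.mul_apply']
  have h' : HasDerivAt ((fun t : ℝ => ((k t : ℝ) : ℂ)) ⋆[ContinuousLinearMap.mul ℝ ℂ, volume] Y)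
      (((fun t : ℝ => ((k t : ℝ) : ℂ)) ⋆[ContinuousLinearMap.mul ℝ ℂ, volume] deriv Y) x) x := h
  rw [e] at h'
  exact h'

/-! ## §2 Pointwise domination, `L²` and `L¹` -/

/-- For each `x`, the integrand `y ↦ k(x−y)Y(y)` is integrable (continuous with compact support). [folklore] -/
theorem integrable_piece_integrand {k : ℝ → ℝ} (hkc : Continuous k) {Y : ℝ → ℂ} (hYc : Continuous Y) (hYs : HasCompactSupport Y)
    (x : ℝ) : Integrable fun y : ℝ => ((k (x - y) : ℝ) : ℂ) * Y y :=
  ((Complex.continuous_ofReal.comp (hkc.comp (continuous_const.sub continuous_id))).mul hYc).integrable_of_hasCompactSupport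
    hYs.mul_left

/-- **Pointwise domination** `‖P(x)‖ ≤ ∫ |k(x−y)|·‖Y(y)‖ dy`. [folklore] -/
theorem norm_piece_le {k : ℝ → ℝ} (hkc : Continuous k) {Y : ℝ → ℂ} (hYc : Continuous Y) (hYs : HasCompactSupport Y) (x : ℝ) :
    ‖∫ y : ℝ, ((k (x - y) : ℝ) : ℂ) * Y y‖ ≤ ∫ y : ℝ, |k (x - y)| * ‖Y y‖ := by
  have hint : Integrable (fun y : ℝ => |k (x - y)| * ‖Y y‖) :=
    ((hkc.comp (continuous_const.sub continuous_id)).abs.mul hYc.norm).integrable_of_hasCompactSupport hYs.norm.mul_left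
  refine norm_integral_le_of_norm_le hint (ae_of_all _ fun y => ?_)
  rw [norm_mul, Complex.norm_real, Real.norm_eq_abs]

/-- **`∫‖P‖² ≤ ‖k‖₁²·∫‖Y‖²`** and `P ∈ L²`. [folklore] -/
theorem integral_sq_norm_piece_le {k : ℝ → ℝ} (hkc : Continuous k) (hki : Integrable k) {Y : ℝ → ℂ} (hYc : Continuous Y)
    (hYs : HasCompactSupport Y) :
    MemLp (fun x : ℝ => ∫ y : ℝ, ((k (x - y) : ℝ) : ℂ) * Y y) 2 volume ∧
      ∫ x : ℝ, ‖∫ y : ℝ, ((k (x - y) : ℝ) : ℂ) * Y y‖ ^ 2 ≤ (∫ t, |k t|) ^ 2 * ∫ y : ℝ, ‖Y y‖ ^ 2 := by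
  have hK : Integrable fun t => |k t| := hki.abs
  have h := integral_sq_norm_le_of_norm_le_integral_mul hK (hYc.memLp_of_hasCompactSupport hYs)
    (continuous_piece hkc hYc hYs).aestronglyMeasurable (ae_of_all _ fun x => norm_piece_le hkc hYc hYs x)
  simpa only [abs_abs] using h

/-- `P ∈ L²`. [folklore] -/
theorem memLp_piece {k : ℝ → ℝ} (hkc : Continuous k) (hki : Integrable k) {Y : ℝ → ℂ} (hYc : Continuous Y)
    (hYs : HasCompactSupport Y) : MemLp (fun x : ℝ => ∫ y : ℝ, ((k (x - y) : ℝ) : ℂ) * Y y) 2 volume :=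
  (integral_sq_norm_piece_le hkc hki hYc hYs).1

/-- `P ∈ L¹` (Young `L¹ × L¹`). [folklore] -/
theorem integrable_piece {k : ℝ → ℝ} (hki : Integrable k) {Y : ℝ → ℂ} (hYc : Continuous Y)
    (hYs : HasCompactSupport Y) : Integrable fun x : ℝ => ∫ y : ℝ, ((k (x - y) : ℝ) : ℂ) * Y y := by
  rw [piece_eq_convolution]
  exact (hki.ofReal.integrable_convolution (ContinuousLinearMap.mul ℝ ℂ) (hYc.integrable_of_hasCompactSupport hYs))

/-! ## §3 Weights: `(τ−c)P ∈ L²`, `x·P ∈ L¹` -/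

/-- **Weighted pointwise domination**: `|x−c|·‖P(x)‖ ≤ ∫|k(x−y)|·(|y−c|‖Y(y)‖)dy + ∫(|x−y||k(x−y)|)·‖Y(y)‖dy`. [folklore] -/
theorem norm_weight_mul_piece_le {k : ℝ → ℝ} (hkc : Continuous k) {Y : ℝ → ℂ} (hYc : Continuous Y) (hYs : HasCompactSupport Y)
    (c x : ℝ) :
    ‖(((x - c : ℝ) : ℂ)) * ∫ y : ℝ, ((k (x - y) : ℝ) : ℂ) * Y y‖
      ≤ (∫ y : ℝ, |k (x - y)| * ‖(((y - c : ℝ) : ℂ)) * Y y‖) + ∫ y : ℝ, (|x - y| * |k (x - y)|) * ‖Y y‖ := by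
  have hsub : Continuous fun y : ℝ => x - y := continuous_const.sub continuous_id
  have hI1 : Integrable (fun y : ℝ => |k (x - y)| * ‖(((y - c : ℝ) : ℂ)) * Y y‖) :=
    (((hkc.comp hsub).abs).mul ((Complex.continuous_ofReal.comp (continuous_id.sub continuous_const)).mul hYc).norm).integrable_of_hasCompactSupport
      (hYs.mul_left).norm.mul_left
  have hI2 : Integrable (fun y : ℝ => (|x - y| * |k (x - y)|) * ‖Y y‖) :=
    ((hsub.abs.mul (hkc.comp hsub).abs).mul hYc.norm).integrable_of_hasCompactSupport hYs.norm.mul_left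
  rw [← integral_const_mul, ← integral_add hI1 hI2]
  have hint : Integrable (fun y : ℝ => (((x - c : ℝ) : ℂ)) * (((k (x - y) : ℝ) : ℂ) * Y y)) :=
    (integrable_piece_integrand hkc hYc hYs x).const_mul _
  refine norm_integral_le_of_norm_le (hI1.add hI2) (ae_of_all _ fun y => ?_)
  simp only [norm_mul, Complex.norm_real, Real.norm_eq_abs]
  have hx : |x - c| ≤ |y - c| + |x - y| := by
    have := abs_sub_le x y c
    linarith [abs_sub_comm x y]
  have hk0 : 0 ≤ |k (x - y)| := abs_nonneg _
  have hY0 : 0 ≤ ‖Y y‖ := norm_nonneg _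
  nlinarith [mul_nonneg hk0 hY0]

/-- **`∫‖(τ−c)P‖² ≤ 2‖k‖₁²∫‖(τ−c)Y‖² + 2‖t·k‖₁²∫‖Y‖²`** and `(τ−c)P ∈ L²`. [folklore] -/
theorem integral_sq_norm_weight_piece_le {k : ℝ → ℝ} (hkc : Continuous k) (hki : Integrable k) (hk1 : Integrable fun t => t * k t)
    {Y : ℝ → ℂ} (hYc : Continuous Y) (hYs : HasCompactSupport Y) (c : ℝ) :
    MemLp (fun x : ℝ => (((x - c : ℝ) : ℂ)) * ∫ y : ℝ, ((k (x - y) : ℝ) : ℂ) * Y y) 2 volume ∧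
      ∫ x : ℝ, ‖(((x - c : ℝ) : ℂ)) * ∫ y : ℝ, ((k (x - y) : ℝ) : ℂ) * Y y‖ ^ 2
        ≤ 2 * ((∫ t, |k t|) ^ 2 * ∫ y : ℝ, ‖(((y - c : ℝ) : ℂ)) * Y y‖ ^ 2)
          + 2 * ((∫ t, |t| * |k t|) ^ 2 * ∫ y : ℝ, ‖Y y‖ ^ 2) := by
  -- the two dominating functions, each controlled by Schur–Young
  have hwY : Continuous fun y : ℝ => (((y - c : ℝ) : ℂ)) * Y y :=
    (Complex.continuous_ofReal.comp (continuous_id.sub continuous_const)).mul hYc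
  have hwYs : HasCompactSupport fun y : ℝ => (((y - c : ℝ) : ℂ)) * Y y := hYs.mul_left
  set A : ℝ → ℝ := fun x => ∫ y : ℝ, |k (x - y)| * ‖(((y - c : ℝ) : ℂ)) * Y y‖ with hA
  set B : ℝ → ℝ := fun x => ∫ y : ℝ, (|x - y| * |k (x - y)|) * ‖Y y‖ with hB
  have h1 : Integrable fun t => |t| * |k t| := by
    refine hk1.abs.congr (ae_of_all _ fun t => ?_); simp only [abs_mul]
  -- measurability of A and B (parametric integrals of continuous integrands)
  have hsub2 : Continuous fun p : ℝ × ℝ => p.1 - p.2 := continuous_fst.sub continuous_snd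
  have hAm : AEStronglyMeasurable A volume := by
    have hF : Continuous fun p : ℝ × ℝ => |k (p.1 - p.2)| * ‖(((p.2 - c : ℝ) : ℂ)) * Y p.2‖ :=
      ((hkc.comp hsub2).abs).mul ((hwY.comp continuous_snd).norm)
    exact (hF.aestronglyMeasurable (μ := (volume : Measure ℝ).prod volume)).integral_prod_right'
  have hBm : AEStronglyMeasurable B volume := by
    have hF : Continuous fun p : ℝ × ℝ => (|p.1 - p.2| * |k (p.1 - p.2)|) * ‖Y p.2‖ :=
      (hsub2.abs.mul (hkc.comp hsub2).abs).mul (hYc.comp continuous_snd).norm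
    exact (hF.aestronglyMeasurable (μ := (volume : Measure ℝ).prod volume)).integral_prod_right'
  obtain ⟨hA2, hAle⟩ := integral_sq_norm_le_of_norm_le_integral_mul (g := A) hki.abs (hwY.memLp_of_hasCompactSupport hwYs) hAm
    (ae_of_all _ fun x => by
      rw [hA, Real.norm_eq_abs, abs_of_nonneg (integral_nonneg fun y => by positivity)])
  obtain ⟨hB2, hBle⟩ := integral_sq_norm_le_of_norm_le_integral_mul (g := B) h1 (hYc.memLp_of_hasCompactSupport hYs) hBm
    (ae_of_all _ fun x => by
      rw [hB, Real.norm_eq_abs, abs_of_nonneg (integral_nonneg fun y => by positivity)])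
  simp only [abs_abs] at hAle
  have hBle' : ∫ x, ‖B x‖ ^ 2 ≤ (∫ t, |t| * |k t|) ^ 2 * ∫ y : ℝ, ‖Y y‖ ^ 2 := by
    refine hBle.trans_eq ?_
    congr 2
    exact integral_congr_ae (ae_of_all _ fun t => by simp only [abs_mul, abs_abs])
  -- the weighted piece is dominated pointwise by A + B
  have hPc : Continuous fun x : ℝ => (((x - c : ℝ) : ℂ)) * ∫ y : ℝ, ((k (x - y) : ℝ) : ℂ) * Y y :=
    (Complex.continuous_ofReal.comp (continuous_id.sub continuous_const)).mul (continuous_piece hkc hYc hYs)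
  have hdom : ∀ x, ‖(((x - c : ℝ) : ℂ)) * ∫ y : ℝ, ((k (x - y) : ℝ) : ℂ) * Y y‖ ≤ A x + B x :=
    fun x => norm_weight_mul_piece_le hkc hYc hYs c x
  have hA0 : ∀ x, 0 ≤ A x := fun x => integral_nonneg fun y => by positivity
  have hB0 : ∀ x, 0 ≤ B x := fun x => integral_nonneg fun y => by positivity
  have hsq : ∀ x, ‖(((x - c : ℝ) : ℂ)) * ∫ y : ℝ, ((k (x - y) : ℝ) : ℂ) * Y y‖ ^ 2 ≤ 2 * ‖A x‖ ^ 2 + 2 * ‖B x‖ ^ 2 := by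
    intro x
    rw [Real.norm_eq_abs, Real.norm_eq_abs, abs_of_nonneg (hA0 x), abs_of_nonneg (hB0 x)]
    have h := hdom x
    have h0 : 0 ≤ ‖(((x - c : ℝ) : ℂ)) * ∫ y : ℝ, ((k (x - y) : ℝ) : ℂ) * Y y‖ := norm_nonneg _
    nlinarith [hA0 x, hB0 x, sq_nonneg (A x - B x)]
  have hIA : Integrable fun x => ‖A x‖ ^ 2 := (memLp_two_iff_integrable_sq_norm hA2.1).1 hA2
  have hIB : Integrable fun x => ‖B x‖ ^ 2 := (memLp_two_iff_integrable_sq_norm hB2.1).1 hB2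
  have hdomI : Integrable fun x => 2 * ‖A x‖ ^ 2 + 2 * ‖B x‖ ^ 2 := (hIA.const_mul 2).add (hIB.const_mul 2)
  have hP2 : MemLp (fun x : ℝ => (((x - c : ℝ) : ℂ)) * ∫ y : ℝ, ((k (x - y) : ℝ) : ℂ) * Y y) 2 volume := by
    rw [memLp_two_iff_integrable_sq_norm hPc.aestronglyMeasurable]
    refine hdomI.mono' (hPc.norm.pow 2).aestronglyMeasurable (ae_of_all _ fun x => ?_)
    rw [Real.norm_eq_abs, abs_of_nonneg (by positivity)]
    exact hsq x
  refine ⟨hP2, ?_⟩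
  calc ∫ x : ℝ, ‖(((x - c : ℝ) : ℂ)) * ∫ y : ℝ, ((k (x - y) : ℝ) : ℂ) * Y y‖ ^ 2
      ≤ ∫ x : ℝ, (2 * ‖A x‖ ^ 2 + 2 * ‖B x‖ ^ 2) :=
        integral_mono ((memLp_two_iff_integrable_sq_norm hP2.1).1 hP2) hdomI hsq
    _ = 2 * (∫ x, ‖A x‖ ^ 2) + 2 * ∫ x, ‖B x‖ ^ 2 := by
        rw [integral_add (hIA.const_mul 2) (hIB.const_mul 2), integral_const_mul, integral_const_mul]
    _ ≤ 2 * ((∫ t, |k t|) ^ 2 * ∫ y : ℝ, ‖(((y - c : ℝ) : ℂ)) * Y y‖ ^ 2) + 2 * ((∫ t, |t| * |k t|) ^ 2 * ∫ y : ℝ, ‖Y y‖ ^ 2) := by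
        gcongr

/-- `(τ−c)P ∈ L²`. [folklore] -/
theorem memLp_weight_piece {k : ℝ → ℝ} (hkc : Continuous k) (hki : Integrable k) (hk1 : Integrable fun t => t * k t)
    {Y : ℝ → ℂ} (hYc : Continuous Y) (hYs : HasCompactSupport Y) (c : ℝ) :
    MemLp (fun x : ℝ => (((x - c : ℝ) : ℂ)) * ∫ y : ℝ, ((k (x - y) : ℝ) : ℂ) * Y y) 2 volume :=
  (integral_sq_norm_weight_piece_le hkc hki hk1 hYc hYs c).1

/-- **`x·P ∈ L¹`**: `|x|‖P(x)‖ ≤ (|t k|∗‖Y‖)(x) + (|k|∗(|y|‖Y‖))(x)`, both `L¹ × L¹` convolutions. [folklore] -/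
theorem integrable_smul_piece {k : ℝ → ℝ} (hkc : Continuous k) (hki : Integrable k) (hk1 : Integrable fun t => t * k t)
    {Y : ℝ → ℂ} (hYc : Continuous Y) (hYs : HasCompactSupport Y) :
    Integrable fun x : ℝ => x • ∫ y : ℝ, ((k (x - y) : ℝ) : ℂ) * Y y := by
  -- dominate by the two real convolutions
  have h1 : Integrable fun t => |t| * |k t| := by
    refine hk1.abs.congr (ae_of_all _ fun t => ?_); simp only [abs_mul]
  have hY1 : Integrable fun y : ℝ => ‖Y y‖ := (hYc.integrable_of_hasCompactSupport hYs).norm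
  have hyY1 : Integrable fun y : ℝ => |y| * ‖Y y‖ :=
    ((continuous_id.abs).mul hYc.norm).integrable_of_hasCompactSupport hYs.norm.mul_left
  have hc1 : Integrable ((fun t => |t| * |k t|) ⋆[ContinuousLinearMap.mul ℝ ℝ, volume] fun y => ‖Y y‖) :=
    h1.integrable_convolution _ hY1
  have hc2 : Integrable ((fun t => |k t|) ⋆[ContinuousLinearMap.mul ℝ ℝ, volume] fun y => |y| * ‖Y y‖) :=
    hki.abs.integrable_convolution _ hyY1
  have hPc := continuous_piece hkc hYc hYs
  refine (hc1.add hc2).mono' ((continuous_id.smul hPc).aestronglyMeasurable) (ae_of_all _ fun x => ?_)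
  rw [Pi.add_apply, convolution_eq_swap, convolution_eq_swap]
  simp only [ContinuousLinearMap.mul_apply', norm_smul, Real.norm_eq_abs]
  -- `|x|‖P x‖ ≤ ∫ |x−y||k(x−y)|‖Y y‖ + ∫ |k(x−y)| |y| ‖Y y‖`
  have hsub : Continuous fun y : ℝ => x - y := continuous_const.sub continuous_id
  have hI1 : Integrable (fun y : ℝ => |x - y| * |k (x - y)| * ‖Y y‖) :=
    ((hsub.abs.mul (hkc.comp hsub).abs).mul hYc.norm).integrable_of_hasCompactSupport hYs.norm.mul_left
  have hI2 : Integrable (fun y : ℝ => |k (x - y)| * (|y| * ‖Y y‖)) :=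
    (((hkc.comp hsub).abs).mul (continuous_id.abs.mul hYc.norm)).integrable_of_hasCompactSupport (hYs.norm.mul_left).mul_left
  rw [← integral_add hI1 hI2]
  have hint : Integrable (fun y : ℝ => (x : ℂ) * (((k (x - y) : ℝ) : ℂ) * Y y)) := (integrable_piece_integrand hkc hYc hYs x).const_mul _
  have hx : |x| * ‖∫ y : ℝ, ((k (x - y) : ℝ) : ℂ) * Y y‖ = ‖∫ y : ℝ, (x : ℂ) * (((k (x - y) : ℝ) : ℂ) * Y y)‖ := by
    rw [integral_const_mul, norm_mul, Complex.norm_real, Real.norm_eq_abs]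
  rw [hx]
  refine norm_integral_le_of_norm_le (hI1.add hI2) (ae_of_all _ fun y => ?_)
  simp only [norm_mul, Complex.norm_real, Real.norm_eq_abs]
  have hxle : |x| ≤ |x - y| + |y| := by
    have := abs_add_le (x - y) y
    simp only [sub_add_cancel] at this
    exact this
  have hk0 : 0 ≤ |k (x - y)| := abs_nonneg _
  have hY0 : 0 ≤ ‖Y y‖ := norm_nonneg _
  nlinarith [mul_nonneg hk0 hY0]

end Summit.NavierStokesRegularity.NavierStokesRegularity.Theorems.MatchedKernel

end
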